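import Summits.QuantumFields.YangMills.Theorems.EquipartitionCriticalityEquipartitionPinsProbeTangentDefs
import Summits.QuantumFields.YangMills.Theorems.EquipartitionCriticalityEquipartitionPinsProbeTangentComb
import Summits.QuantumFields.YangMills.Theorems.EquipartitionCriticalityEquipartitionPinsProbeTangentLieFrame
import Summits.QuantumFields.YangMills.Theorems.EquipartitionCriticalityEquipartitionPinsProbeTangentPlaquetteEnergy
import Summits.QuantumFields.YangMills.Theorems.EquipartitionCriticalityEquipartitionPinsProbeTangentCombPoincare
import Summits.QuantumFields.YangMills.Theorems.EquipartitionCriticalityEquipartitionPinsProbeTangentPlaqFieldContinuous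
import HarnessLib

/-!
# Uniform second moments of the rescaled plaquette field along torus-limit states

Crux `stmt-QuantumFields-8760` (`EquipartitionPinsProbe`), line `Sketch`, stub `stub_fieldMoments` (TM)
of the reshaped `stub_tangentCore`.

For a lattice representation `r` of the compact group `G`, a sequence `β_k → ∞` and torus-limit
states `μ_k ∈ infiniteVolumeLimitPoints r.ρ β_k`, every coordinate `Y_p^a = plaqField r β_k U p a` of
the rescaled plaquette field has second moments bounded uniformly in `k`:

* pointwise, `Y² ≤ 4 Σ_i A_i²` (Cauchy–Schwarz over the four boundary links), and
  `A_i² = (√β)² · lieCoord((ρ(Ũ_{e_i}) − 1))_a² ≤ (√β)² · 2 (N − Re tr ρ(Ũ_{e_i}))` by Bessel's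
  inequality for the orthonormal frame (`stub_lieFrame`) and the unitary identity
  `Re tr((V − 1)(V − 1)†) = 2 (N − Re tr V)`;
* crude bound: `U ↦ Y²(U)` is continuous (`stub_plaqFieldContinuous`) on the compact configuration
  space `G^{edges}`, hence bounded for each fixed `k` (integrability, and the finitely many `k`
  before the asymptotic regime);
* fine bound: the comb Poincaré inequality (`stub_combPoincare`) dominates `N − Re tr ρ(Ũ_e)` by
  plaquette energies, whose rescaled expectations `β ∫ (N − Re tr ρ(U_q)) dμ` are `≤ 3D/2 + 1`
  eventually in `β`, uniformly over torus-limit states (`stub_plaquetteEnergy`).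

Reference: S. Chatterjee, arXiv:1602.01222, §§9, 11.
-/

noncomputable section

open scoped Matrix
open MeasureTheory Filter Topology
open Literature.MathematicalPhysics.QuantumLattice Literature.MathematicalPhysics.QuantumFieldTheory

namespace Summit.QuantumFields.YangMills.Theorems.EquipartitionPinsProbe

namespace TangentFieldMoments

/-! ### Matrix inequalities -/

section MatrixFacts

variable {N : ℕ}

/-- For a unitary matrix `V`: `Re tr((V − 1)(V − 1)†) = 2 (N − Re tr V)` (`V V† = 1`). -/
theorem trace_sub_one_mul_conjTranspose_re {V : Matrix (Fin N) (Fin N) ℂ}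
    (hV : V ∈ Matrix.unitaryGroup (Fin N) ℂ) :
    ((V - 1) * (V - 1)ᴴ).trace.re = 2 * ((N : ℝ) - V.trace.re) := by
  have hVV : V * Vᴴ = 1 := by
    have h := Matrix.mem_unitaryGroup_iff.1 hV
    rwa [Matrix.star_eq_conjTranspose] at h
  have h : (V - 1) * (V - 1)ᴴ = 1 - V - (Vᴴ - 1) := by
    rw [Matrix.conjTranspose_sub, Matrix.conjTranspose_one, sub_mul, one_mul, mul_sub, mul_one, hVV]
  rw [h, Matrix.trace_sub, Matrix.trace_sub, Matrix.trace_sub, Matrix.trace_one,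
    Matrix.trace_conjTranspose, Fintype.card_fin]
  simp only [Complex.sub_re, Complex.natCast_re, Complex.star_def, Complex.conj_re]
  ring

end MatrixFacts

/-! ### Pointwise bounds on the rescaled fields -/

section Pointwise

variable {G : Type} [Group G] [TopologicalSpace G] [CompactSpace G] (r : LatticeRep G)

/-- Bessel for a single coordinate: `lieCoord r M a ² ≤ Re tr(M M†)`. -/
theorem lieCoord_sq_le (M : Matrix (Fin r.N) (Fin r.N) ℂ) (a : Fin (lieDim r)) :
    lieCoord r M a ^ 2 ≤ (M * Mᴴ).trace.re :=
  (Finset.single_le_sum (f := fun b => lieCoord r M b ^ 2) (fun _ _ => sq_nonneg _)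
    (Finset.mem_univ a)).trans ((stub_lieFrame G r).2.2.2.2 M)

/-- `lieCoord r (ρ g − 1) a ² ≤ 2 (N − Re tr ρ g)` (Bessel and the unitary identity). -/
theorem lieCoord_sub_one_sq_le (g : G) (a : Fin (lieDim r)) :
    lieCoord r (r.ρ g - 1) a ^ 2 ≤ 2 * ((r.N : ℝ) - (r.ρ g).trace.re) :=
  (lieCoord_sq_le r _ a).trans_eq (trace_sub_one_mul_conjTranspose_re (r.mem_unitary g))

/-- A squared link field: `A_e² ≤ (√β)² · 2 (N − Re tr ρ(Ũ_e))`. -/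
theorem linkField_sq_le (β : ℝ) (U : LGConfig 4 G)
    (e : Literature.MathematicalPhysics.QuantumLattice.ZdEdge 4) (a : Fin (lieDim r)) :
    linkField r β U e a ^ 2 ≤
      Real.sqrt β ^ 2 * (2 * ((r.N : ℝ) - (r.ρ (axialFix U e)).trace.re)) := by
  rw [linkField, mul_pow]
  exact mul_le_mul_of_nonneg_left (lieCoord_sub_one_sq_le r _ a) (sq_nonneg _)

/-- **Pointwise bound**: `Y_p^a ² ≤ 4 Σ_i (√β)² · 2 (N − Re tr ρ(Ũ_{∂_i p}))` (Cauchy–Schwarz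
over the four boundary links, then `linkField_sq_le`). -/
theorem plaqField_sq_le (β : ℝ) (U : LGConfig 4 G) (p : ZdPlaquette 4) (a : Fin (lieDim r)) :
    plaqField r β U p a ^ 2 ≤ 4 * ∑ i : Fin 4, Real.sqrt β ^ 2 *
      (2 * ((r.N : ℝ) - (r.ρ (axialFix U (plaquetteBoundary p i))).trace.re)) := by
  have hcs := sq_sum_le_card_mul_sum_sq (s := (Finset.univ : Finset (Fin 4)))
    (f := fun i => plaquetteBoundarySign i * linkField r β U (plaquetteBoundary p i) a)
  rw [Finset.card_univ, Fintype.card_fin] at hcs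
  refine hcs.trans ?_
  push_cast
  refine mul_le_mul_of_nonneg_left (Finset.sum_le_sum fun i _ => ?_) (by norm_num)
  have hsign : plaquetteBoundarySign i ^ 2 = 1 := by
    fin_cases i <;> simp [plaquetteBoundarySign]
  rw [mul_pow, hsign, one_mul]
  exact linkField_sq_le r β U _ a

end Pointwise

/-! ### Continuity, boundedness, integrability and the eventual moment bound -/

section Moments

variable {G : Type} [Group G] [TopologicalSpace G] [IsTopologicalGroup G] (r : LatticeRep G)

/-- `U ↦ Y_p^a(U)²` is continuous (`stub_plaqFieldContinuous` and the evaluations). -/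
theorem continuous_plaqField_sq (β : ℝ) (p : ZdPlaquette 4) (a : Fin (lieDim r)) :
    Continuous fun U : LGConfig 4 G => plaqField r β U p a ^ 2 :=
  ((continuous_apply a).comp ((continuous_apply p).comp (stub_plaqFieldContinuous G r β).1)).pow 2

variable [CompactSpace G]

/-- **Crude bound**: `Y_p^a ²` is bounded on the compact configuration space `G^{edges}`, for
each fixed `β`. -/
theorem exists_plaqField_sq_le (β : ℝ) (p : ZdPlaquette 4) (a : Fin (lieDim r)) :
    ∃ c : ℝ, ∀ U : LGConfig 4 G, plaqField r β U p a ^ 2 ≤ c := by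
  obtain ⟨c, hc⟩ :=
    (isCompact_univ.image (continuous_plaqField_sq r β p a)).isBounded.bddAbove
  exact ⟨c, fun U => hc ⟨U, Set.mem_univ _, rfl⟩⟩

variable [MeasurableSpace G] [BorelSpace G] [SecondCountableTopology G]

/-- `Y_p^a ²` is integrable for every finite measure (continuous, hence measurable for second
countable `G`, and bounded). -/
theorem integrable_plaqField_sq (β : ℝ) (μ : Measure (LGConfig 4 G)) [IsFiniteMeasure μ]
    (p : ZdPlaquette 4) (a : Fin (lieDim r)) :
    Integrable (fun U => plaqField r β U p a ^ 2) μ := by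
  obtain ⟨c, hc⟩ := exists_plaqField_sq_le r β p a
  refine Integrable.of_bound (continuous_plaqField_sq r β p a).measurable.aestronglyMeasurable
    c (ae_of_all _ fun U => ?_)
  rw [Real.norm_of_nonneg (sq_nonneg _)]
  exact hc U

/-- The crude moment bound: a pointwise bound `Y_p^a ² ≤ c` integrates to `∫ Y_p^a ² dμ ≤ c` for a
probability measure. -/
theorem integral_plaqField_sq_le_of_le (β : ℝ) (μ : Measure (LGConfig 4 G))
    [IsProbabilityMeasure μ] (p : ZdPlaquette 4) (a : Fin (lieDim r)) {c : ℝ}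
    (hc : ∀ U : LGConfig 4 G, plaqField r β U p a ^ 2 ≤ c) :
    ∫ U, plaqField r β U p a ^ 2 ∂μ ≤ c := by
  refine (integral_mono (integrable_plaqField_sq r β μ p a) (integrable_const _) hc).trans_eq ?_
  simp

/-- **The fine moment bound**: if `0 ≤ β` and every rescaled plaquette energy of the probability
measure `μ` is `≤ E` (`β ∫ (N − Re tr ρ(U_q)) dμ ≤ E` with integrable integrands), then
`∫ Y_p^a ² dμ ≤ Σ_i Σ_{q ∈ S_i} 8 C_i E`, where `(S_e, C_e)` are comb-Poincaré data of the
boundary edges. -/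
theorem integral_plaqField_sq_le {β : ℝ} (hβ : 0 ≤ β) (μ : Measure (LGConfig 4 G))
    [IsProbabilityMeasure μ]
    (p : ZdPlaquette 4) (a : Fin (lieDim r))
    (S : Literature.MathematicalPhysics.QuantumLattice.ZdEdge 4 → Finset (ZdPlaquette 4))
    (C : Literature.MathematicalPhysics.QuantumLattice.ZdEdge 4 → ℝ) (hC : ∀ e, 0 ≤ C e)
    (hSC : ∀ e (U : LGConfig 4 G), (r.N : ℝ) - (r.ρ (axialFix U e)).trace.re ≤ C e *
      ∑ q ∈ S e, ((r.N : ℝ) - (r.ρ (plaquetteHolonomyZd U q.1 q.2.1.1 q.2.1.2)).trace.re))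
    {E : ℝ} (hE : ∀ q : ZdPlaquette 4,
      β * ∫ U, ((r.N : ℝ) - plaquetteObs r.ρ q.1 q.2.1.1 q.2.1.2 U) ∂μ ≤ E) :
    ∫ U, plaqField r β U p a ^ 2 ∂μ ≤
      ∑ i : Fin 4, ∑ _q ∈ S (plaquetteBoundary p i), 8 * C (plaquetteBoundary p i) * E := by
  -- pointwise fine bound
  have hpt : ∀ U : LGConfig 4 G, plaqField r β U p a ^ 2 ≤
      ∑ i : Fin 4, ∑ q ∈ S (plaquetteBoundary p i), (8 * C (plaquetteBoundary p i) * β) *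
        ((r.N : ℝ) - plaquetteObs r.ρ q.1 q.2.1.1 q.2.1.2 U) := fun U => by
    refine (plaqField_sq_le r β U p a).trans ?_
    rw [Finset.mul_sum]
    refine Finset.sum_le_sum fun i _ => ?_
    have h1 : Real.sqrt β ^ 2 *
        (2 * ((r.N : ℝ) - (r.ρ (axialFix U (plaquetteBoundary p i))).trace.re)) ≤
        β * (2 * (C (plaquetteBoundary p i) * ∑ q ∈ S (plaquetteBoundary p i),
          ((r.N : ℝ) - plaquetteObs r.ρ q.1 q.2.1.1 q.2.1.2 U))) := by
      rw [Real.sq_sqrt hβ]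
      exact mul_le_mul_of_nonneg_left (mul_le_mul_of_nonneg_left (hSC _ U) (by norm_num)) hβ
    refine (mul_le_mul_of_nonneg_left h1 (by norm_num)).trans_eq ?_
    rw [Finset.mul_sum, Finset.mul_sum, Finset.mul_sum, Finset.mul_sum]
    exact Finset.sum_congr rfl fun q _ => by ring
  have hint : ∀ q : ZdPlaquette 4,
      Integrable (fun U => (r.N : ℝ) - plaquetteObs r.ρ q.1 q.2.1.1 q.2.1.2 U) μ := fun q =>
    TangentPlaquetteEnergy.integrable_sub_plaquetteObs r.ρ r.continuous r.mem_unitary μ _ _ _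
  have hintR : Integrable (fun U => ∑ i : Fin 4, ∑ q ∈ S (plaquetteBoundary p i),
      (8 * C (plaquetteBoundary p i) * β) *
        ((r.N : ℝ) - plaquetteObs r.ρ q.1 q.2.1.1 q.2.1.2 U)) μ :=
    integrable_finsetSum _ fun i _ => integrable_finsetSum _ fun q _ => (hint q).const_mul _
  refine (integral_mono (integrable_plaqField_sq r β μ p a) hintR hpt).trans ?_
  rw [integral_finsetSum _ fun i _ => integrable_finsetSum _ fun q _ => (hint q).const_mul _]
  refine Finset.sum_le_sum fun i _ => ?_
  rw [integral_finsetSum _ fun q _ => (hint q).const_mul _]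
  refine Finset.sum_le_sum fun q _ => ?_
  rw [integral_const_mul, mul_assoc]
  exact mul_le_mul_of_nonneg_left (hE q) (by linarith [hC (plaquetteBoundary p i)])

end Moments

end TangentFieldMoments

open TangentFieldMoments in
/-- STUB TM — **uniform second moments of the rescaled plaquette field**: along `β_k → ∞` and
torus-limit states `μ_k`, every coordinate `Y_p^a` of `plaqField r β_k · p a` is square
integrable with `sup_k ∫ (Y_p^a)² dμ_k < ∞` (Bessel + the unitary identity
`‖V − 1‖² = 2(N − Re tr V)`, the comb Poincaré inequality, and the uniform plaquette energy
bound). -/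
theorem stub_fieldMoments :
    ∀ (G : Type) [Group G] [TopologicalSpace G] [IsTopologicalGroup G] [CompactSpace G],
      Literature.MathematicalPhysics.QuantumFieldTheory.IsCompactSimpleLieGroup G →
      letI : MeasurableSpace G := borel G
      haveI : BorelSpace G := ⟨rfl⟩
      ∀ r : Literature.MathematicalPhysics.QuantumFieldTheory.LatticeRep G,
        (∀ ε : ℝ, 0 < ε → ∀ᶠ β : ℝ in Filter.atTop,
          ∀ μ ∈ Literature.MathematicalPhysics.QuantumLattice.infiniteVolumeLimitPoints (d := 4) r.ρ β,
            |β * (∫ U, (∑ i : Fin 4, ∑ j : Fin 4,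
                if i < j then ((r.N : ℝ) - Literature.MathematicalPhysics.QuantumLattice.plaquetteObs r.ρ 0 i j U) else 0) ∂μ) -
              3 * (Summit.QuantumFields.YangMills.Theorems.EquipartitionPinsProbe.lieDim r : ℝ) / 2| < ε) →
        ∀ (β : ℕ → ℝ) (μ : ℕ → MeasureTheory.Measure (Literature.MathematicalPhysics.QuantumLattice.LGConfig 4 G)),
          Filter.Tendsto β Filter.atTop Filter.atTop →
          (∀ k, μ k ∈ Literature.MathematicalPhysics.QuantumLattice.infiniteVolumeLimitPoints (d := 4) r.ρ (β k)) →
          ∀ (p : Literature.MathematicalPhysics.QuantumLattice.ZdPlaquette 4) (a : Fin (Summit.QuantumFields.YangMills.Theorems.EquipartitionPinsProbe.lieDim r)), ∃ C : ℝ, ∀ k : ℕ,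
            MeasureTheory.Integrable (fun U => (Summit.QuantumFields.YangMills.Theorems.EquipartitionPinsProbe.plaqField r (β k) U p a) ^ 2) (μ k) ∧
            ∫ U, (Summit.QuantumFields.YangMills.Theorems.EquipartitionPinsProbe.plaqField r (β k) U p a) ^ 2 ∂(μ k) ≤ C := by
  intro G _ _ _ _ hG r hequi β μ hβ hμ p a
  letI : MeasurableSpace G := borel G
  haveI : BorelSpace G := ⟨rfl⟩
  haveI : SecondCountableTopology G :=
    (r.continuous.isClosedEmbedding r.injective).isEmbedding.secondCountableTopology
  have hprob : ∀ k, IsProbabilityMeasure (μ k) := fun k => by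
    obtain ⟨L, -, hprob, -⟩ := hμ k
    exact hprob
  -- comb-Poincaré data for every edge
  choose S C hC hSC using stub_combPoincare G r.ρ r.mem_unitary
  -- the asymptotic regime: `β ≥ β₀ ≥ 0` gives the uniform plaquette energy bound
  obtain ⟨β₀, hβ₀⟩ := Filter.eventually_atTop.1
    ((stub_plaquetteEnergy G hG r hequi).and (Filter.eventually_ge_atTop 0))
  obtain ⟨k₀, hk₀⟩ := Filter.eventually_atTop.1 (Filter.tendsto_atTop.1 hβ β₀)
  -- constants
  set E : ℝ := 3 * (lieDim r : ℝ) / 2 + 1 with hEdef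
  set C₁ : ℝ := ∑ i : Fin 4, ∑ _q ∈ S (plaquetteBoundary p i), 8 * C (plaquetteBoundary p i) * E
  -- crude pointwise bounds `Y² ≤ c k` (compactness), used for the finitely many `k < k₀`
  choose c hc using fun k => exists_plaqField_sq_le r (β k) p a
  have hc0 : ∀ k, 0 ≤ c k := fun k => (sq_nonneg _).trans (hc k fun _ => 1)
  refine ⟨max C₁ (∑ k ∈ Finset.range k₀, c k), fun k =>
    ⟨integrable_plaqField_sq r (β k) (μ k) p a, ?_⟩⟩
  rcases le_or_gt k₀ k with hk | hk
  · -- asymptotic regime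
    obtain ⟨hP, hβk0⟩ := hβ₀ (β k) (hk₀ k hk)
    refine le_trans ?_ (le_max_left _ _)
    exact integral_plaqField_sq_le r hβk0 (μ k) p a S C hC hSC fun q => ((hP (μ k) (hμ k)) q).2
  · -- finitely many small `k`: the crude bound
    refine le_trans ?_ (le_max_right _ _)
    exact (integral_plaqField_sq_le_of_le r (β k) (μ k) p a (hc k)).trans
      (Finset.single_le_sum (f := c) (fun j _ => hc0 j) (Finset.mem_range.2 hk))

end Summit.QuantumFields.YangMills.Theorems.EquipartitionPinsProbe

end
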